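import Literature.Claims.NS.Washburn2026
import HarnessLib

/-!
# NS-claims map, C159 (Washburn 2026): the «Topological Frustration Pinch» lemma (Thm 6.11) is TRUE —
# elementary cosh calculus (salvage, kernel)

Claim C159 of cell `ns-claims` (D-0090): Jonathan Washburn, *Global Regularity for the 3D
Incompressible Navier–Stokes Equations via the Topological Frustration Pinch*, Zenodo record 19490305
(bib `Washburn2026`), skeleton `Literature.Claims.NS.Washburn2026` (typist ns-claims-typist-7 g7).
Theorem 6.11 p.8 l.40–84 (with Def 6.1 p.7, Def 6.9 p.8) is typed as `Theorem611_TFPinch`: for a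
balanced opposite-pair neighbourhood with weights `wᵢ > 0` and log-ratios `±ϑᵢ` (`m > 0` pairs), the
cost `F(η) = Σᵢ wᵢ (J(e^{η−ϑᵢ}) + J(e^{η+ϑᵢ}))`, `J(x) = ½(x + x⁻¹) − 1`, is strictly convex with
unique minimiser `η = 0`, `F′(0) = 0`, `F(0) = 2Σᵢ wᵢ(cosh ϑᵢ − 1)`, and `F(0) = 0` iff all `ϑᵢ = 0`.
This is elementary and TRUE: `J(eˢ) = cosh s − 1` and `cosh(η−ϑ) + cosh(η+ϑ) = 2 cosh η cosh ϑ` give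
the closed form `F(η) = A cosh η − B` with `A = 2Σᵢ wᵢ cosh ϑᵢ > 0`, `B = 2Σᵢ wᵢ` (`Fpair_eq`), from
which all five clauses follow (`cosh` is strictly convex with `cosh η > 1 ⇔ η ≠ 0`).  The lemma carries
no PDE content; the refuter's located step of the row is `Theorem75_const` (§8), not this one.

* `theorem611_holds : Literature.Claims.NS.Washburn2026.Theorem611_TFPinch`.

Records-grade TRUE-column object; announce-first honoured (typist-7 g7 12:21:15Z: not MINE).  Salvage
seat ns-claims-salvage-p4 g4.  Axioms: `propext`, `Classical.choice`, `Quot.sound` only.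
WHAT THIS IS NOT: not a claim about NS regularity or blow-up; not a claim about any author beyond
the typed locator.
-/

noncomputable section

open Set Finset

-- The summit's canonical theorem namespace repeats the summit name (single-conjunct summit).
set_option linter.dupNamespace false

namespace Summit.NavierStokesRegularity.NavierStokesRegularity.Theorems.Washburn2026

open Literature.Claims.NS.Washburn2026

/-- `J(eˢ) = cosh s − 1`. [cite: Washburn2026, Def 6.1 p.7] -/
theorem J_exp (s : ℝ) : J (Real.exp s) = Real.cosh s - 1 := by
  rw [J, Real.cosh_eq, ← Real.exp_neg]

/-- **Closed form of the pair cost**: `F(η) = (Σᵢ 2wᵢ cosh ϑᵢ) cosh η − Σᵢ 2wᵢ`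
(`cosh(η−ϑ) + cosh(η+ϑ) = 2 cosh η cosh ϑ`). [cite: Washburn2026, Def 6.9 p.8] -/
theorem Fpair_eq {m : ℕ} (wt th : Fin m → ℝ) (η : ℝ) :
    Fpair wt th η = (∑ i, 2 * (wt i * Real.cosh (th i))) * Real.cosh η - ∑ i, 2 * wt i := by
  unfold Fpair
  have h : ∀ i, wt i * (J (Real.exp (η - th i)) + J (Real.exp (η + th i))) =
      2 * (wt i * Real.cosh (th i)) * Real.cosh η - 2 * wt i := by
    intro i
    rw [J_exp, J_exp, Real.cosh_sub, Real.cosh_add]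
    ring
  rw [Finset.sum_congr rfl fun i _ => h i, Finset.sum_sub_distrib, Finset.sum_mul]

/-- The coefficient `A = Σᵢ 2wᵢ cosh ϑᵢ` is positive (`m > 0`, `wᵢ > 0`, `cosh ≥ 1`). [folklore] -/
theorem coeff_pos {m : ℕ} {wt : Fin m → ℝ} (th : Fin m → ℝ) (hm : 0 < m) (hw : ∀ i, 0 < wt i) :
    0 < ∑ i, 2 * (wt i * Real.cosh (th i)) := by
  haveI : Nonempty (Fin m) := ⟨⟨0, hm⟩⟩
  refine Finset.sum_pos (fun i _ => ?_) Finset.univ_nonempty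
  have := hw i
  have := Real.cosh_pos (th i)
  positivity

/-- `cosh x = 1 ↔ x = 0`. [folklore] -/
theorem cosh_eq_one_iff (x : ℝ) : Real.cosh x = 1 ↔ x = 0 := by
  constructor
  · intro h
    by_contra hx
    have := Real.one_lt_cosh.2 hx
    linarith
  · rintro rfl; exact Real.cosh_zero

/-- **Theorem 6.11 holds** (Topological Frustration Pinch at a zero node, clauses (i)–(iii) and the
vanishing criterion): strict convexity, unique minimiser `0`, `F′(0) = 0`,
`F(0) = 2Σᵢ wᵢ(cosh ϑᵢ − 1)`, `F(0) = 0 ↔ ∀ i, ϑᵢ = 0` — elementary `cosh` calculus on the closed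
form `F(η) = A cosh η − B`. [cite: Washburn2026, Thm 6.11 p.8 l.40–84; Def 6.1 p.7; Def 6.9 p.8] -/
theorem theorem611_holds : Theorem611_TFPinch := by
  intro m wt th hm hw
  -- closed form
  set A : ℝ := ∑ i, 2 * (wt i * Real.cosh (th i)) with hA
  set B : ℝ := ∑ i, 2 * wt i with hB
  have hF : Fpair wt th = fun η => A * Real.cosh η - B := by
    funext η; rw [Fpair_eq]
  have hA0 : 0 < A := coeff_pos th hm hw
  -- derivatives of the closed form
  have hd1 : ∀ η, HasDerivAt (fun η => A * Real.cosh η - B) (A * Real.sinh η) η := fun η =>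
    ((Real.hasDerivAt_cosh η).const_mul A).sub_const B
  have hderiv : deriv (fun η => A * Real.cosh η - B) = fun η => A * Real.sinh η :=
    funext fun η => (hd1 η).deriv
  have hd2 : ∀ η, HasDerivAt (fun η => A * Real.sinh η) (A * Real.cosh η) η := fun η =>
    (Real.hasDerivAt_sinh η).const_mul A
  have hderiv2 : ∀ η, deriv^[2] (fun η => A * Real.cosh η - B) η = A * Real.cosh η := by
    intro η
    rw [Function.iterate_succ_apply, Function.iterate_one, hderiv]
    exact (hd2 η).deriv
  refine ⟨?_, ?_, ?_, ?_, ?_⟩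
  · -- (i) strict convexity
    rw [hF]
    refine strictConvexOn_univ_of_deriv2_pos (by fun_prop) fun η => ?_
    rw [hderiv2]
    exact mul_pos hA0 (Real.cosh_pos η)
  · -- unique minimiser at 0
    intro η hη
    rw [hF]
    simp only [Real.cosh_zero, mul_one]
    have := Real.one_lt_cosh.2 hη
    nlinarith
  · -- (ii) F'(0) = 0
    rw [hF, hderiv]
    simp
  · -- (iii) F(0) = 2 Σ wᵢ (cosh ϑᵢ - 1)
    rw [hF]
    simp only [Real.cosh_zero, mul_one]
    rw [hA, hB, ← Finset.sum_sub_distrib, Finset.mul_sum]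
    refine Finset.sum_congr rfl fun i _ => ?_
    ring
  · -- vanishing criterion
    rw [hF]
    simp only [Real.cosh_zero, mul_one]
    rw [hA, hB, ← Finset.sum_sub_distrib]
    have hterm : ∀ i, 2 * (wt i * Real.cosh (th i)) - 2 * wt i = 2 * wt i * (Real.cosh (th i) - 1) := by
      intro i; ring
    simp_rw [hterm]
    have hnn : ∀ i ∈ (Finset.univ : Finset (Fin m)), 0 ≤ 2 * wt i * (Real.cosh (th i) - 1) := by
      intro i _
      have := hw i
      have := Real.one_le_cosh (th i)
      nlinarith
    rw [Finset.sum_eq_zero_iff_of_nonneg hnn]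
    refine ⟨fun h i => ?_, fun h i _ => ?_⟩
    · have hi := h i (Finset.mem_univ i)
      have hwi := hw i
      have : Real.cosh (th i) - 1 = 0 := by
        rcases mul_eq_zero.1 hi with h1 | h1
        · exfalso; linarith
        · exact h1
      exact (cosh_eq_one_iff (th i)).1 (by linarith)
    · rw [h i, Real.cosh_zero]; ring

end Summit.NavierStokesRegularity.NavierStokesRegularity.Theorems.Washburn2026

end
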